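import Literature.AlgebraicGeometry.AbelianSchemes.AbelianSchemeOverBase
import Literature.AlgebraicGeometry.AbelianSchemes.AbelianSchemeOverField
import Literature.AlgebraicGeometry.Motives.AbelianVarietyProjectiveChart
import Literature.AlgebraicGeometry.Morphisms.ProjectiveMorphismComposition
import Literature.AlgebraicGeometry.Morphisms.FinsetInAffineOpenOfProjective
import Literature.AlgebraicGeometry.Morphisms.AffineOfNilpotentThickening
import HarnessLib

/-!
# Finite sets of points lie in affine opens: along nilpotent thickenings of the base, and for abelian schemes over
# Artinian local rings ([SGA3I] Exp. V Thm. 4.1 hypothesis (b); [StacksProject] Tag 06AD; [MumfordAV1970] §12 Thm. 1)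

Layer `Literature/AlgebraicGeometry`, namespaces `Literature.AlgebraicGeometry.Morphisms` (§1) and
`Literature.AlgebraicGeometry.AbelianSchemes.AbelianSchemeOver` (§2).  THEOREMS ONLY (no definition, no instance, no notation, no named fact,
no `sorry`).

THE PRINT.  The quotient of a scheme by a finite locally free groupoid ∕ group scheme ([SGA3I] Exp. V Thm. 4.1, condition (b);
[MumfordAV1970] §12 Thm. 1 (p. 111); [GortzWedhorn2023] Thm. 27.68) asks that every finite set of points (every orbit) lie in an AFFINE
open.  Over a field this holds for any (quasi-)projective scheme (★ `Morphisms.exists_isAffineOpen_forall_mem_of_isProjective`, [EGAII] Cor.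
4.5.4), in particular for abelian varieties (★ `Motives.AbelianVariety.isProjectiveOver_holds`).  THIS FILE transports it along NILPOTENT THICKENINGS of
the base: if `ρ : R ↠ R₀` is surjective with nilpotent kernel and `Q₀ = Q ×_R R₀`, then `Q₀ ↪ Q` is a surjective closed immersion with
nilpotent ideal, so `Q` and `Q₀` have the same opens and an open of `Q` is affine as soon as its trace on `Q₀` is ([StacksProject] Tag 06AD,
★ `Morphisms.isAffineOpen_of_isPullback_specMap`).

* §1 **`Morphisms.exists_isAffineOpen_forall_mem_of_isPullback_specMap`** — `ρ : R ↠ R₀` surjective with nilpotent kernel,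
  `hQ : IsPullback iQ q₀ q (Spec ρ)`, and every finite set of points of `Q₀` lies in an affine open ⇒ the same for `Q`.
* §2 **`AbelianSchemeOver.exists_isAffineOpen_forall_mem_of_isArtinianRing`** — for an abelian scheme `X` over `Spec A`, `A` ARTINIAN
  LOCAL, every finite set of points of `X` lies in an affine open (§1 along `A ↠ A⁄𝔪_A`, `𝔪_A` nilpotent; the closed fibre is an abelian
  variety, hence projective).  This is hypothesis (b) of the finite-flat quotient `X ⧸ Z` over the Artinian bases of the Serre–Tate ∕
  Drinfeld lifting argument ([Katz1981SerreTate] proof of Thm. 1.2.1: «we may form the quotient abelian scheme of `B` by `K`»).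

Cell hodgecm-mathlib (D-0151 ∕ D-0183 FLOOR 0), P6 «MOD programme» Row 4 (P6b), organ (O4)∕(O5) support: discharges the affine-orbit binder
of `stub_L4B1uQ_quotientByFiniteFlatSubgroup` (sub-line `F0_P6b_MumfordDualFlat`) at Artinian local bases; generic, count-neutral capital on
`--supports stmt-HodgeConjecture-24832`.  HC_CM is proved only modulo the printed citations until rung 0 closes; nothing here is about HC.

## References
* [SGA3I] M. Demazure, A. Grothendieck, *Schémas en groupes I* (SGA 3, Tome I), LNM 151 (1970), Exp. V (P. Gabriel) Thm. 4.1.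
* [StacksProject] The Stacks Project, Tag 06AD (thickenings and affineness).
* [EGAII] A. Grothendieck, *EGA II*, Publ. Math. IHÉS 8 (1961), Cor. 4.5.4.
* [MumfordAV1970] D. Mumford, *Abelian Varieties* (1970), §12 Thm. 1 (p. 111).
* [Katz1981SerreTate] N. M. Katz, *Serre–Tate local moduli*, LNM 868 (1981), §1.2, proof of Thm. 1.2.1 (pp. 141–142).
-/

set_option autoImplicit false

noncomputable section

open CategoryTheory AlgebraicGeometry Topology

universe u

namespace Literature.AlgebraicGeometry.Morphisms

/-! ### §1 Transport along a nilpotent thickening of the base -/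

/-- **Finite sets of points lie in affine opens, along a nilpotent thickening of the base.**  Let `ρ : R ↠ R₀` be surjective with nilpotent
kernel, `q : Q → Spec R`, `q₀ : Q₀ → Spec R₀` and `hQ : IsPullback iQ q₀ q (Spec ρ)` (`Q₀ = Q ×_R R₀`).  If every finite set of points of `Q₀`
lies in an affine open of `Q₀`, then every finite set of points of `Q` lies in an affine open of `Q`: `iQ` is a surjective closed immersion
(`Spec ρ` is onto, its image `V(ker ρ)` being everything), hence a homeomorphism onto `Q`, and an open of `Q` whose trace on `Q₀` is affine is
affine (★ `isAffineOpen_of_isPullback_specMap`). [cite: StacksProject, Tag 06AD] [cite: SGA3I, Exp. V Thm. 4.1] -/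
theorem exists_isAffineOpen_forall_mem_of_isPullback_specMap {R R₀ : Type u} [CommRing R] [CommRing R₀] (ρ : R →+* R₀)
    (hρ : Function.Surjective ρ) (hnil : IsNilpotent (RingHom.ker ρ)) {Q Q₀ : Scheme.{u}} {q : Q ⟶ Spec (.of R)}
    {q₀ : Q₀ ⟶ Spec (.of R₀)} {iQ : Q₀ ⟶ Q} (hQ : IsPullback iQ q₀ q (Spec.map (CommRingCat.ofHom ρ)))
    (h₀ : ∀ F₀ : Finset Q₀, ∃ U₀ : Q₀.Opens, IsAffineOpen U₀ ∧ ∀ x ∈ F₀, x ∈ U₀) (F : Finset Q) :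
    ∃ U : Q.Opens, IsAffineOpen U ∧ ∀ x ∈ F, x ∈ U := by
  classical
  haveI : IsClosedImmersion iQ :=
    MorphismProperty.of_isPullback hQ.flip (IsClosedImmersion.spec_of_surjective _ hρ)
  -- `Spec ρ` is surjective: its range is `V(ker ρ)`, and `ker ρ` is contained in every prime
  have hSρ : Surjective (Spec.map (CommRingCat.ofHom ρ)) := by
    refine ⟨fun x => ?_⟩
    have hx : x ∈ Set.range (Spec.map (CommRingCat.ofHom ρ)) := by
      have h1 : Set.range (Spec.map (CommRingCat.ofHom ρ)) = PrimeSpectrum.zeroLocus (RingHom.ker ρ) :=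
        range_comap_of_surjective _ _ hρ
      rw [h1]
      intro a ha
      obtain ⟨n, hn⟩ := hnil
      have han : a ^ n ∈ RingHom.ker ρ ^ n := Ideal.pow_mem_pow ha n
      rw [hn, Ideal.zero_eq_bot, Ideal.mem_bot] at han
      exact x.2.mem_of_pow_mem n (han ▸ x.asIdeal.zero_mem)
    exact hx
  haveI : Surjective iQ := MorphismProperty.of_isPullback hQ.flip hSρ
  -- move the points to `Q₀`, take an affine open there, and read it as the trace of an open of `Q`
  have hs : ∀ x : Q, ∃ y : Q₀, iQ y = x := iQ.surjective
  choose s hs using hs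
  obtain ⟨U₀, hU₀, hFU₀⟩ := h₀ (F.image s)
  obtain ⟨t, ht, hpre⟩ := iQ.isClosedEmbedding.isInducing.isOpen_iff.mp U₀.isOpen
  have hUt : iQ ⁻¹ᵁ (⟨t, ht⟩ : Q.Opens) = U₀ := TopologicalSpace.Opens.ext hpre
  refine ⟨⟨t, ht⟩, ?_, fun x hx => ?_⟩
  · refine isAffineOpen_of_isPullback_specMap ρ hρ hnil hQ ?_
    rw [hUt]
    exact hU₀
  · have hsx : s x ∈ U₀ := hFU₀ _ (Finset.mem_image_of_mem s hx)
    rw [← hUt] at hsx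
    have hsx' : iQ (s x) ∈ (⟨t, ht⟩ : Q.Opens) := hsx
    rwa [hs x] at hsx'

end Literature.AlgebraicGeometry.Morphisms

namespace Literature.AlgebraicGeometry.AbelianSchemes.AbelianSchemeOver

open Literature.AlgebraicGeometry

/-! ### §2 Abelian schemes over Artinian local rings -/

/-- **Finite sets of points of an abelian scheme over an ARTINIAN LOCAL ring lie in affine opens** — hypothesis (b) of the quotient by a
finite flat subgroup scheme ([SGA3I] Exp. V Thm. 4.1; [MumfordAV1970] §12 Thm. 1 over a field), at the bases of the Serre–Tate ∕ Drinfeld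
lifting argument.  Proof: `𝔪_A` is nilpotent, `X ×_A (A⁄𝔪_A)` is an abelian variety over the residue field, hence projective (★
`Motives.AbelianVariety.isProjectiveOver_holds`), so its finite sets of points lie in affine opens (★ `exists_isAffineOpen_forall_mem_of_isProjective`);
transport by §1. [cite: SGA3I, Exp. V Thm. 4.1] [cite: MumfordAV1970, §12 Thm. 1 (p. 111)] [cite: Katz1981SerreTate, proof of Theorem 1.2.1] -/
theorem exists_isAffineOpen_forall_mem_of_isArtinianRing (A : Type) [CommRing A] [IsArtinianRing A] [IsLocalRing A]
    (X : AbelianSchemeOver (Spec (.of A))) (F : Finset X.X.left) :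
    ∃ U : X.X.left.Opens, IsAffineOpen U ∧ ∀ x ∈ F, x ∈ U := by
  -- the residue map `ρ : A ↠ k`, surjective with nilpotent kernel `𝔪_A`
  have hρ : Function.Surjective (IsLocalRing.residue A) := IsLocalRing.residue_surjective
  have hnil : IsNilpotent (RingHom.ker (IsLocalRing.residue A)) := by
    rw [IsLocalRing.ker_residue, ← IsLocalRing.jacobson_eq_maximalIdeal (⊥ : Ideal A) bot_ne_top]
    exact IsArtinianRing.isNilpotent_jacobson_bot
  -- the closed fibre `X_k`, an abelian variety over the residue field, is projective
  have hproj : Morphisms.IsProjective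
      (X.baseChange (Spec.map (CommRingCat.ofHom (IsLocalRing.residue A)))).X.hom :=
    Morphisms.IsProjective.of_isProjectiveOver
      (Motives.AbelianVariety.isProjectiveOver_holds
        (X.baseChange (Spec.map (CommRingCat.ofHom (IsLocalRing.residue A)))).toAffine.toAbelianVariety)
  have h₀ : ∀ F₀ : Finset (X.baseChange (Spec.map (CommRingCat.ofHom (IsLocalRing.residue A)))).X.left,
      ∃ U₀ : (X.baseChange (Spec.map (CommRingCat.ofHom (IsLocalRing.residue A)))).X.left.Opens,
        IsAffineOpen U₀ ∧ ∀ x ∈ F₀, x ∈ U₀ := fun F₀ =>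
    Morphisms.exists_isAffineOpen_forall_mem_of_isProjective hproj F₀
  exact Morphisms.exists_isAffineOpen_forall_mem_of_isPullback_specMap (IsLocalRing.residue A) hρ hnil
    (IsPullback.of_hasPullback X.X.hom (Spec.map (CommRingCat.ofHom (IsLocalRing.residue A)))) h₀ F

end Literature.AlgebraicGeometry.AbelianSchemes.AbelianSchemeOver

end
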